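import Summits.BirchSwinnertonDyer.Rank1Residual.X2.ClassClosureO9
import Summits.BirchSwinnertonDyer.Rank1Residual.Partition.MainConjectures
import Literature.NumberTheory.EllipticCurves.Skinner2016.MultiplicativeMainConjecture
import HarnessLib

/-!
# Rank one at a NON-SPLIT multiplicative prime, ANY image: Mazur's main conjecture at the pair +
# the Schneider certificate ⟹ `BSD(E,p)` (Disegni 2020 Thm. 4 + Jones), and the X11b ∩ (ram) corollary
# from Skinner 2016 Thm. A (cell `b2b-bsdres`, lane CLASS-CLOSURE, seat `cc-typer-6`; pointer for x11b3)

HONEST FRAMING (run/shared/lean/b2b/bsd-rank1-residual/, verbatim in every file): the goal of the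
cell is to DELETE the COMBINATION-SHAPED residual classes of the Birch–Swinnerton-Dyer formula for
ALL analytic-rank `≤ 1` elliptic curves over `ℚ` — "full BSD formula for every rank `≤ 1` curve in
class `C`" assembled STRICTLY from published theorems — so that the rank-`≤ 1` remainder becomes
exactly the CONSTRUCTION-SHAPED classes, which are TYPED (missing-input `Prop`s), NOT attempted.
This is not "finishing BSD". Research routes; NO CLAIM BEYOND STATED CLASSES; nothing here changes a
label (X11b stays CONSTRUCTION-SHAPED, X2c likewise) — the marks are the referee's. THEOREMS ONLY (no
definition, no new named fact): every published theorem enters as one of the tree's existing named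
Literature facts BY NAME; the Schneider certificate is a PER-PAIR hypothesis; nothing about any
particular curve is asserted.

## What this file records

`X2/ClassClosureO9.lean` (this seat, p249649) proved, on the reducible class X2c, that at a NON-split
multiplicative prime Mazur's main conjecture at the pair plus the pair's Schneider certificate give
`BSD(E,p)` from PUBLISHED facts, the rank-one leading-term comparison being Disegni, Kyoto J. Math. 60
(2020) Thm. 4 (vendored `Disegni2020.padicBSD_rankOne_nonsplitMult`, p249273). That proof never used
reducibility. Here the statement is recorded WITHOUT any image hypothesis and composed with Skinner
2016 Thm. A, which PROVES Mazur's main conjecture at `p ‖ N`, `p ≥ 3`, for IRREDUCIBLE `E[p]` with a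
ramified multiplicative prime (ram):

* (used, not restated) lit-glue's `X2.mazurMainConjectureAt_of_thmA` (`Partition/MainConjectures.lean`):
  Skinner 2016 Thm. A ⟹ the cell's typed statement `X2.MazurMainConjectureAt W p` at `p ≥ 3`, `p ‖ N`,
  (irr), (ram);
* `bsdp_of_not_split_of_analyticRank_eq_one_of_mazurMainConjectureAt_of_schneider` — ANY `E/ℚ`,
  `p ≠ 2` non-split multiplicative, `ord_{s=1} L(E,s) = 1`: MC at the pair + Schneider certificate ⟹
  `BSD(E,p)` (Disegni Thm. 4 `hDis`, Stein–Wuthrich Thm. 6.1 `hJn`, SW §4.2 height existence `hHn`,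
  Gross–Zagier `hGZ`, GZK `hGZK`, modularity `hpar`; data instantiated from tree theorems);
* **`X11b.bsdp_of_ram_of_not_split_of_schneider`** — `ClassX11b W p` (`r = 1`, `p` odd, `p ‖ N`,
  `E[p]` irreducible) ∧ `Ram W p` ∧ non-split `p`: `BSD(E,p)` from PUBLISHED facts MODULO THE PAIR'S
  SCHNEIDER CERTIFICATE ONLY (`ord_{T=0} L_p(E,T) = 1` for THE non-split Mazur–Tate–Teitelbaum
  function; no height, no Heegner point, no STEP L, no preprint) — at EVERY odd `p`, `p = 3` INCLUDED
  (Skinner 2016 is printed for `p ≥ 3`; Disegni for every prime of ordinary reduction). This replaces,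
  on the non-split (ram) part of N8 (`p ≥ 5`) and O2 (`p = 3`), the per-pair NUMERICAL certificate
  `hcert` of `Typed.X11.bsdp_of_thmA_nonsplit_of_certificate` / `Record.CertNonsplit` by a theorem;
  the `Ram`-free part of X11b (= X11a-type at rank one) and the SPLIT part are untouched (split:
  Disegni Thm. 4 second clause is exact only with a second multiplicative prime, `p ≥ 5`, and rests
  on Venerucci 2016 — irreducible `E[p]`, which X11b HAS: a reading for x11b3, not vendored here).

POINTER, not a booking: the x11b3 team / cc-typer-3 own N8/O2; referee A rules on any mark. Reading
flags that ride: the identifications recorded in the Disegni fact's docstring (Nekovář height =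
Schneider/Mazur–Tate height = SW §4.2 (4.1) at a non-split prime; `L_p` = MTT by Amice–Vélu–Vishik).

References: [Disegni2020] Thm. 4; [Skinner2016PacificMC] Thm. A, §3.2–3.3; [SteinWuthrich2013]
Thm. 6.1, §4.2; [MazurTateTeitelbaum1986Invent] §I.10–I.14; [Miller2011LMS] Def. 1.1, Prop. 7.6;
RESIDUAL-MAP.md §I N8 / O2, §C; CLASS-CLOSURE-PLAN.md §3.10.
-/

set_option autoImplicit false

noncomputable section

open scoped Classical MatrixGroups ModularForm

open PowerSeries CongruenceSubgroup WeierstrassCurve Literature.NumberTheory.EllipticCurves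
  Literature.NumberTheory.EllipticCurves.ModularForms
  Literature.NumberTheory.EllipticCurves.Rank1Residual
  Literature.NumberTheory.EllipticCurves.Rank1Residual.Typed
  Literature.NumberTheory.EllipticCurves.Skinner2016
  Literature.NumberTheory.EllipticCurves.Wuthrich2014
  Literature.NumberTheory.EllipticCurves.SteinWuthrich2013
  Literature.NumberTheory.EllipticCurves.Disegni2020

namespace Summit.BirchSwinnertonDyer.Rank1Residual

/-! ## §1. Non-split multiplicative `p`, rank one, ANY image: MC + Schneider ⟹ `BSD(E,p)` -/

/-- **Rank one at a NON-SPLIT multiplicative prime, no image hypothesis: Mazur's main conjecture at the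
pair + the pair's Schneider certificate ⟹ `BSD(E,p)`, from PUBLISHED facts** — Disegni 2020 Thm. 4
(`hDis`: the `p`-adic versus complex leading terms), Stein–Wuthrich 2013 Thm. 6.1 (`hJn`: Jones'
algebraic leading term), SW §4.2 height existence (`hHn`), Gross–Zagier (`hGZ`), GZK (`hGZK`),
modularity (`hpar`); the cyclotomic data, `X(E/ℚ_∞)`, the newform and `ϖ`, THE non-split
Mazur–Tate–Teitelbaum function and the Tate parameter are INSTANTIATED from tree theorems; engine =
eisenstein-p2's `X2.certificate_iff_schneider_and_bsdp_of_mazurMainConjectureAt_nonsplit`. The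
image-free form of `X2.bsdp_of_cellC_of_not_split_of_mazurMainConjectureAt_of_schneider`.
[cite: Disegni2020, Thm. 4 (§3.2)] [cite: SteinWuthrich2013, Thm. 6.1 (p. 20), §3.1 (p. 9), §4.2]
[cite: Miller2011LMS, Def. 1.1 and Prop. 7.6] -/
theorem bsdp_of_not_split_of_analyticRank_eq_one_of_mazurMainConjectureAt_of_schneider
    (hDis : padicBSD_rankOne_nonsplitMult) (hJn : thm61_nonsplitMultiplicative)
    (hHn : exists_isMultCanonical) (hGZ : GrossZagier1986_thm_I_7_3)
    (hGZK : rank_eq_analyticRank_of_analyticRank_le_one) (hpar : nonempty_modularParametrizationData)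
    (W : WeierstrassCurve ℚ) [W.IsElliptic] [W.IsGloballyMinimal] (p : ℕ) [Fact p.Prime]
    (hp2 : p ≠ 2) (hmult : W.HasMultiplicativeReductionAtPrime p)
    (hns : ¬ W.HasSplitMultiplicativeReductionAtPrime p) (hr1 : W.analyticRank = 1)
    (hMC : X2.MazurMainConjectureAt W p)
    (hSch : ∀ (q : ℚ_[p]) (Dh : PAdicHeightData W p), q ≠ 0 → ‖q‖ < 1 → tateJ q = (W.j : ℚ_[p]) →
      IsMultCanonical Dh q → SchneiderConjecture Dh) :
    BSDp W p := by
  obtain ⟨κ, hκ, γ, hγ, hγ'⟩ := exists_isCyclotomic_isTopGenerator_isCyclotomicVariable_holds p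
  obtain ⟨D⟩ := W.nonempty_selmerDualData_holds κ γ hγ
  haveI : NeZero (W.conductorNorm ℤ) := ⟨(W.conductorNorm_pos_holds).ne'⟩
  obtain ⟨Dm⟩ := hpar W
  obtain ⟨ϖ, hϖpos, hϖ, -⟩ := Dm.exists_rat_mul_realPeriodRat_eq_plusPeriod
  obtain ⟨L, hL⟩ := exists_isMultPAdicLFunctionOf_neg_one_of_nonsplit Dm.isNewformOf hmult hns
  obtain ⟨q, ⟨hq0, hq1, hqj⟩, -⟩ := existsUnique_tateJ_eq_of_one_lt_norm
    (one_lt_norm_j_of_hasMultiplicativeReductionAtPrime (W := W) (p := p) hmult)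
  obtain ⟨Dh, hDh⟩ := hHn W p hp2 hmult hns q hq0 hq1 hqj
  obtain ⟨s, hs⟩ := X2.exists_rat_shaAn_eq_of_analyticRank_eq_one hGZ hGZK W hr1
  have hrank : W.mordellWeilRank = 1 := by rw [(hGZK W hr1.le).1, hr1]
  have hReg : padicRegulator Dh ≠ 0 := hSch q Dh hq0 hq1 hqj hDh
  obtain ⟨hord, hval⟩ :=
    (hDis W p hp2 hmult hns hr1 κ γ hκ hγ hγ' Dm.f Dm.isNewformOf ϖ hϖ L hL q hq0 hq1 hqj Dh hDh s hs).2
      hReg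
  exact ((X2.certificate_iff_schneider_and_bsdp_of_mazurMainConjectureAt_nonsplit hJn hGZK W p hp2
    hr1.le hMC hmult hns hq0 hq1 hqj hDh hκ hγ hγ' Dm.isNewformOf D ϖ hϖpos.ne' hϖ L hL hs).mp
      ⟨by rw [hrank]; exact hord, by rw [hrank]; simpa using hval⟩).2

/-! ## §2. X11b ∩ (ram), NON-split `p`: `BSD(E,p)` modulo the Schneider certificate -/

namespace X11b

/-- **X11b ∧ (ram) ∧ non-split `p` ⟹ `BSD(E,p)` from PUBLISHED facts, modulo the pair's Schneider
certificate only** (every odd `p`, `p = 3` included): for `W/ℚ` globally minimal elliptic and `p` with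
`ClassX11b W p` (`ord_{s=1} L(E,s) = 1`, `p` odd, `p ‖ N`, `E[p]` irreducible), a ramified multiplicative
prime `ℓ ≠ p` (`Ram W p`) and NON-split reduction at `p`: Mazur's main conjecture is Skinner 2016
Thm. A (`hA`), the leading terms are Disegni 2020 Thm. 4 (`hDis`) and Stein–Wuthrich 2013 Thm. 6.1
(`hJn`); with SW §4.2 height existence (`hHn`), Gross–Zagier (`hGZ`), GZK (`hGZK`), modularity
(`hpar`). The per-pair binder `hSch` is Schneider's non-degeneracy of THE §4.2 height — equivalently
`ord_{T=0} L_p(E,T) = 1` (a finite `p`-adic computation when it holds). No Heegner point, no STEP L,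
no preprint. A pointer for the N8 / O2 owners; no label changes. [cite: Skinner2016PacificMC, Thm. A]
[cite: Disegni2020, Thm. 4 (§3.2)] [cite: SteinWuthrich2013, Thm. 6.1 (p. 20), §3.1 (p. 9), §4.2]
[cite: Miller2011LMS, Def. 1.1 and Prop. 7.6] -/
theorem bsdp_of_ram_of_not_split_of_schneider (hA : thmA_charIdeal_multiplicative)
    (hDis : padicBSD_rankOne_nonsplitMult) (hJn : thm61_nonsplitMultiplicative)
    (hHn : exists_isMultCanonical) (hGZ : GrossZagier1986_thm_I_7_3)
    (hGZK : rank_eq_analyticRank_of_analyticRank_le_one) (hpar : nonempty_modularParametrizationData)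
    (W : WeierstrassCurve ℚ) [W.IsElliptic] [W.IsGloballyMinimal] (p : ℕ) [Fact p.Prime]
    (hX : ClassX11b W p) (hram : Ram W p) (hns : ¬ W.HasSplitMultiplicativeReductionAtPrime p)
    (hSch : ∀ (q : ℚ_[p]) (Dh : PAdicHeightData W p), q ≠ 0 → ‖q‖ < 1 → tateJ q = (W.j : ℚ_[p]) →
      IsMultCanonical Dh q → SchneiderConjecture Dh) :
    BSDp W p := by
  obtain ⟨hr1, hp2, hmult, hirr⟩ := hX
  have hp3 : 3 ≤ p := by
    have h2 := (Fact.out : p.Prime).two_le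
    omega
  exact bsdp_of_not_split_of_analyticRank_eq_one_of_mazurMainConjectureAt_of_schneider hDis hJn hHn hGZ
    hGZK hpar W p hp2 hmult hns hr1 (X2.mazurMainConjectureAt_of_thmA hA hp3 hmult hirr hram) hSch

end X11b

end Summit.BirchSwinnertonDyer.Rank1Residual

end
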